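import Summits.CriticalPhenomena.PercolationContinuityZ3.Theorems.Transplant.SkelPhiKits
import Summits.CriticalPhenomena.PercolationContinuityZ3.Theorems.Transplant.SkelPhiSeedKitHab
import Summits.CriticalPhenomena.PercolationContinuityZ3.Theorems.Transplant.SkelKitsHab
import HarnessLib

/-!
# D″ node, φ-level generic layer ((B″), V98 p1 column; p3-g7 03:54:39Z (3) "take the Ω-twins too"): the KIT CLAUSE of a window level in the
# HABITAT graph `winGraphIn G Ω` — the corridor residue (C)'s per-level `hkits` — from the plain deep-slab kit of the window `(w₀, R)` PADDED
# over `Ω` (`Skelφ.habPad`, `SkelPhiSeedKitHab`); φ-level re-cut of `SkelKitsHab` (p238675, p3-g5), with the near contact's Step IV taken as a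
# per-contact hypothesis (§2, engine-agnostic) and instantiated with the two-scale rectangle kit via `KNLevels.stepIV_out` (§3)

builds on p205010 (kernel theorem, internal audit signed; external expert review pending) — nothing in this file uses p205010.
Lane `prim-bschramm`, seat `prim-bschramm-p1` (gen 9); helper file (`--supports stmt-CriticalPhenomena-4575 --as helper`).

Setting: a plain window `(w₀, R)`, its level-`j` box `Icc (lo − j) (hi + j)`, the deep seed slab (`slabGeomDeep`, scale `ℓs`, tangential
offset `T₀ = tanOff ℓs M`, near depth `r₀`) with near faces `Unear`, and a habitat `Ω` with **`hfull : winLevel G φ w₀ R lo hi j ⊆ Ω`**.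
The exploration graph is `Γ := winGraphIn G Ω` (`IsSubbox Γ Wt q D`, `winLevelIn φ Ω lo hi j ⊆ D`), the Step-III data are
`kitSDataHab … (habPad … (slabGeomDeep …))`, the pinning set is `pinSetHab := Win (shell box) R ∪ farSetHab` (`farSetHab` = inner neighbours of
the far plain contacts and of the padded contacts).  The Φ-free `SkelI.kitSeed_congr` / `SkelI.mem_kitSeed_pad` are imported (`SkelKitsHab`).
* §1 `farSetHab`, `pinSetHab`, `shellWin_subset_winLevel`, `farSetHab_spec`, `pinSetHab_subset_winLevelIn`, `pinSetHab_spec`;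
* §2 **`kitClauseHab`** — `∃ σ S, SHyp (winLDataIn G φ Ω lo hi o Sfin) j σ ∧ σ.N ≤ N ∧ (1 − q^{sB})^k ≤ δ ∧ S ⊆ B⟨j⟩ ∧ S ⊆ D ∧ seeds off
  wireSet S ∧ faces ⊆ S ∧ hIV`, for ANY near-face map meeting `NearFaceOKDeep` + shell-box room; per `Ω`-contact: a face vertex of the PADDED
  geometry in `T`, or — a PLAIN NEAR contact — the Step-IV estimate of the near face w.r.t. `pinSetHab` (hypothesis);
* §3 **`kitClauseHab'`** — §2 with the rectangle faces `rectU` and Step IV by `KNLevels.stepIV_out` over `winGraphIn G Ω` from the `G`-level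
  inputs at the kit centre (as `Skelφ.kitClause'`; rooms from `SkelPhiSlabRect` / `SkelPhiKits` §3, inside `Ω` through `hfull`).
[cite: KozmaNitzan2024, §4 Lemma 10, Steps III–V (pp. 19–22)] [cite: GrimmettPercolation1999, §7.2]
-/

noncomputable section

open MeasureTheory
open scoped Classical

namespace Summit.CriticalPhenomena.PercolationContinuityZ3.Theorems.Transplant

namespace Skelφ

open Literature.Probability.Percolation Literature.Probability.LatticeModels SimpleGraph KNLevels
open Literature.Probability.Percolation.KozmaNitzan.Cells (oth oth_ne eq_oth_of_ne oth_oth)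
open Literature.Barriers.CriticalPhenomena (graphBall graphBall_finite mem_graphBall_self graphBall_mono)
open Skel (winGraph winGraph_adj winGraph_le KitGeom winGraphIn winGraphIn_adj winGraphIn_le)
open SkelI (kitSeed mem_kitSeed_cases kitSeed_congr mem_kitSeed_pad tanOff)

variable {V : Type} [DecidableEq V] (G : SimpleGraph V) [G.LocallyFinite] (φ : V → Site 2)

/-! ## §1 The pinning set over `Ω` -/

/-- **The far set over `Ω`**: the inner neighbours (`(habPad … κ).y`) of the `Ω`-contacts of level `j` that are NOT plain near contacts
(padded contacts, and plain contacts with `inNbr x ∉ B_G(w₀, R − r₀)`). [cite: KozmaNitzan2024, §4 p. 21 ("Q ⊆ S")] -/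
def farSetHab (Ω : Finset V) (w₀ : V) (R : ℕ) (lo hi : Site 2) (j r₀ : ℕ) (κ : KitGeom V) : Finset V :=
  ((outerBoundary (winGraphIn G Ω) (winLevelIn φ Ω lo hi j)).filter fun x =>
      ¬ (x ∈ outerBoundary (winGraph G w₀ R) (winLevel G φ w₀ R lo hi j) ∧
        inNbr G φ w₀ R (Finset.Icc (lo - (j : Site 2)) (hi + (j : Site 2))) x ∈ graphBall G w₀ (R - r₀))).image
    fun x => (habPad G φ Ω w₀ R lo hi j κ).y x

/-- **The pinning set of the window level `j` over `Ω`**: the shell window together with the far set. [cite: KozmaNitzan2024, §4 p. 21 ("Q ⊆ S")] -/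
def pinSetHab (Ω : Finset V) (w₀ : V) (R : ℕ) (lo hi : Site 2) (j ℓs r₀ : ℕ) (κ : KitGeom V) : Finset V :=
  Win G φ w₀ (Finset.Icc ((lo - (j : Site 2)) + ((2 * ℓs + 2 : ℕ) : Site 2)) ((hi + (j : Site 2)) - ((2 * ℓs + 2 : ℕ) : Site 2))) R ∪
    farSetHab G φ Ω w₀ R lo hi j r₀ κ

omit [DecidableEq V] in
/-- The shell window lies in the plain level `B⟨j⟩`. [folklore] -/
theorem shellWin_subset_winLevel (w₀ : V) (R : ℕ) (lo hi : Site 2) (j ℓs : ℕ) :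
    Win G φ w₀ (Finset.Icc ((lo - (j : Site 2)) + ((2 * ℓs + 2 : ℕ) : Site 2)) ((hi + (j : Site 2)) - ((2 * ℓs + 2 : ℕ) : Site 2))) R ⊆
      winLevel G φ w₀ R lo hi j := fun _ hv =>
  (mem_winLevel_iff G φ).2 ⟨((mem_Win G φ).1 hv).1, SkelI.mem_Icc_of_mem_shell ((mem_Win G φ).1 hv).2⟩

section Pin

variable {G φ}
variable {Ω : Finset V} {w₀ : V} {R : ℕ} {lo hi : Site 2} {j ℓs M R' r₀ : ℕ} {Unear : V → Finset V}

/-- Members of the far set: the inner neighbour of a padded contact or of a far plain contact; either way in the habitat level (the plain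
one through `hfull`), with skeleton coordinate OFF the shrunk box `Icc (Lo + 1) (Hi − 1)` (a neighbour of a vertex off the box, `Lip`) and at
depth `> R − r₀` from `w₀` (`1 ≤ r₀ ≤ R`). [folklore] -/
theorem farSetHab_spec (hlip : Lip G φ) (hfull : winLevel G φ w₀ R lo hi j ⊆ Ω) (hr₀ : 1 ≤ r₀) (hR : r₀ ≤ R) {v : V}
    (hv : v ∈ farSetHab G φ Ω w₀ R lo hi j r₀ (slabGeomDeep G φ w₀ R lo hi j ℓs M R' r₀ Unear)) :
    v ∈ winLevelIn φ Ω lo hi j ∧ φ v ∉ Finset.Icc ((lo - (j : Site 2)) + 1) ((hi + (j : Site 2)) - 1) ∧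
      v ∉ graphBall G w₀ (R - r₀) := by
  rw [farSetHab, Finset.mem_image] at hv
  obtain ⟨x, hx, rfl⟩ := hv
  rw [Finset.mem_filter] at hx
  obtain ⟨hxK, hxfar⟩ := hx
  have hxK' : x ∈ outerBoundary (winGraphIn G Ω) (WinIn φ Ω (Finset.Icc (lo - (j : Site 2)) (hi + (j : Site 2)))) := hxK
  obtain ⟨-, hxP, -⟩ := (mem_outerBoundary_winIn_iff G φ).1 hxK'
  -- off the shrunk box: a neighbour of `x`, whose coordinate is off the box
  have hshr : ∀ y, G.Adj x y → φ y ∉ Finset.Icc ((lo - (j : Site 2)) + 1) ((hi + (j : Site 2)) - 1) := by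
    intro y hxy hy
    have h := φ_mem_Icc_enlarge_of_adj hlip hy hxy.symm
    rw [add_sub_cancel_right, sub_add_cancel] at h
    exact hxP h
  by_cases hp : x ∈ outerBoundary (winGraph G w₀ R) (winLevel G φ w₀ R lo hi j)
  · -- a far plain contact: `y = inNbr x`
    have hfar : inNbr G φ w₀ R (Finset.Icc (lo - (j : Site 2)) (hi + (j : Site 2))) x ∉ graphBall G w₀ (R - r₀) :=
      fun h => hxfar ⟨hp, h⟩
    rw [(habPad_of_mem hp).1]
    have hp' : x ∈ outerBoundary (winGraph G w₀ R) (Win G φ w₀ (Finset.Icc (lo - (j : Site 2)) (hi + (j : Site 2))) R) := hp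
    obtain ⟨hadj, hyR, hyP⟩ := inNbr_spec hp'
    have hy : (slabGeomDeep G φ w₀ R lo hi j ℓs M R' r₀ Unear).y x =
        inNbr G φ w₀ R (Finset.Icc (lo - (j : Site 2)) (hi + (j : Site 2))) x := rfl
    rw [hy]
    exact ⟨winLevel_subset_winLevelIn hfull ((mem_winLevel_iff G φ).2 ⟨hyR, hyP⟩), hshr _ hadj, hfar⟩
  · -- a padded contact: `y = inNbrIn x`
    rw [(habPad_of_not_mem hp).1]
    obtain ⟨hadj, -, -⟩ := inNbrIn_spec hxK'
    exact ⟨inNbrIn_mem_winLevelIn hxK, hshr _ hadj, inNbrIn_not_mem_graphBall hxK hp (by omega)⟩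

/-- The pinning set lies in the habitat level `B⟨j⟩ = winLevelIn φ Ω lo hi j`. [folklore] -/
theorem pinSetHab_subset_winLevelIn (hlip : Lip G φ) (hfull : winLevel G φ w₀ R lo hi j ⊆ Ω) (hr₀ : 1 ≤ r₀) (hR : r₀ ≤ R) :
    pinSetHab G φ Ω w₀ R lo hi j ℓs r₀ (slabGeomDeep G φ w₀ R lo hi j ℓs M R' r₀ Unear) ⊆ winLevelIn φ Ω lo hi j := by
  intro v hv
  rw [pinSetHab, Finset.mem_union] at hv
  rcases hv with hv | hv
  · exact winLevel_subset_winLevelIn hfull (shellWin_subset_winLevel G φ w₀ R lo hi j ℓs hv)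
  · exact (farSetHab_spec hlip hfull hr₀ hR hv).1

/-- Members of the pinning set are shell vertices or far boundary-layer vertices (the `hT` shape of `slabSeedDeep_notMem_wireSet`). [folklore] -/
theorem pinSetHab_spec (hlip : Lip G φ) (hfull : winLevel G φ w₀ R lo hi j ⊆ Ω) (hr₀ : 1 ≤ r₀) (hR : r₀ ≤ R) :
    ∀ v ∈ (↑(pinSetHab G φ Ω w₀ R lo hi j ℓs r₀ (slabGeomDeep G φ w₀ R lo hi j ℓs M R' r₀ Unear)) : Set V),
      φ v ∈ Finset.Icc (lo - (j : Site 2)) (hi + (j : Site 2)) ∧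
      (φ v ∈ Finset.Icc ((lo - (j : Site 2)) + ((2 * ℓs + 2 : ℕ) : Site 2)) ((hi + (j : Site 2)) - ((2 * ℓs + 2 : ℕ) : Site 2)) ∨
        (φ v ∉ Finset.Icc ((lo - (j : Site 2)) + 1) ((hi + (j : Site 2)) - 1) ∧ v ∉ graphBall G w₀ (R - r₀))) := by
  intro v hv
  rw [Finset.mem_coe] at hv
  refine ⟨((mem_winLevelIn_iff φ).1 (pinSetHab_subset_winLevelIn hlip hfull hr₀ hR hv)).2, ?_⟩
  rw [pinSetHab, Finset.mem_union] at hv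
  rcases hv with hv | hv
  · exact Or.inl ((mem_Win G φ).1 hv).2
  · exact Or.inr (farSetHab_spec hlip hfull hr₀ hR hv).2

end Pin

/-! ## §2 The kit clause over the habitat graph -/

variable {G φ}

/-- **The kit clause of `KitsAt` / `TargetProperty` for a window level in the habitat graph `winGraphIn G Ω`**, from a plain deep-slab kit
of the window `(w₀, R)` padded over `Ω` (`hfull : winLevel ⊆ Ω`), for ANY near-face map meeting `NearFaceOKDeep` with faces in the shell box;
per `Ω`-contact: a face vertex of the PADDED geometry in `T`, or (plain near contact) the Step-IV estimate of the near face w.r.t. `pinSetHab`.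
[cite: KozmaNitzan2024, §4 Lemma 10, Steps III–IV (pp. 19–21)] -/
theorem kitClauseHab [Countable V] (hlip : Lip G φ) (hstep : Steps G φ) {Δ : ℕ} (hΔ : ∀ v, G.degree v ≤ Δ) {q : unitInterval} {δ : ℝ}
    (hδ : 0 < δ)
    -- the plain window level and the slab constants
    {w₀ : V} {R : ℕ} {lo hi : Site 2} {j ℓs M R' r₀ rs : ℕ} (hℓs : 1 ≤ ℓs)
    (hwide : ∀ i, (lo - (j : Site 2)) i + 2 * tanOff ℓs M ≤ (hi + (j : Site 2)) i)
    (hR' : ∀ c : V, graphBall G c (ℓs + 2 + 2 * tanOff ℓs M) ∩ cyl φ c ℓs ⊆ cylBall G φ c ℓs R')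
    (hr₀ : ℓs + 1 + tanOff ℓs M + R' ≤ r₀) (hR : r₀ ≤ R) (hrs : ℓs + 2 + tanOff ℓs M + R' ≤ rs)
    {Unear : V → Finset V} {cU : ℕ} (hU : NearFaceOKDeep G φ w₀ R lo hi j ℓs M R' r₀ rs cU Unear)
    (hUsh : ∀ x ∈ outerBoundary (winGraph G w₀ R) (winLevel G φ w₀ R lo hi j), ∀ u ∈ Unear x,
      φ u ∈ Finset.Icc ((lo - (j : Site 2)) + ((2 * ℓs + 2 : ℕ) : Site 2)) ((hi + (j : Site 2)) - ((2 * ℓs + 2 : ℕ) : Site 2)))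
    -- the habitat, the level's source/support, the weighting, the region and the target
    {Ω : Finset V} (hfull : winLevel G φ w₀ R lo hi j ⊆ Ω)
    (k : ℕ) (o : V) (Sfin : Finset V) {Wt : Sym2 V → unitInterval} {D T : Finset V}
    (hXD : winLevelIn φ Ω lo hi j ⊆ D) {N : ℕ} (hN : k * (Δ + 1) ^ (2 * rs) ≤ N)
    (hk : (1 - (q : ℝ) ^ (1 + Δ * ((Δ + 1) ^ R' + (tanOff ℓs M + 2)) + ((Δ + 1) ^ R' + (tanOff ℓs M + 2)) * cU)) ^ k ≤ δ)
    -- per `Ω`-contact: a padded-face vertex in the target, or (plain near contact) the Step-IV estimate of the near face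
    (hcon : ∀ x ∈ outerBoundary (winGraphIn G Ω) (winLevelIn φ Ω lo hi j),
      (∃ u ∈ (habPad G φ Ω w₀ R lo hi j (slabGeomDeep G φ w₀ R lo hi j ℓs M R' r₀ Unear)).U x, u ∈ T) ∨
      (x ∈ outerBoundary (winGraph G w₀ R) (winLevel G φ w₀ R lo hi j) ∧
        inNbr G φ w₀ R (Finset.Icc (lo - (j : Site 2)) (hi + (j : Site 2))) x ∈ graphBall G w₀ (R - r₀) ∧
        1 - 3 * δ ≤ (prodBernoulli Wt).real {ω | ∃ u ∈ Unear x,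
          1 - δ < (prodBernoulli (pinW Wt (wireSet
            (↑(pinSetHab G φ Ω w₀ R lo hi j ℓs r₀ (slabGeomDeep G φ w₀ R lo hi j ℓs M R' r₀ Unear)) : Set V)) ω)).real
            (⋃ t ∈ T, openConnIn (↑D : Set V) u t)})) :
    ∃ (σ : SData V) (S : Finset V), SHyp (winLDataIn G φ Ω lo hi o Sfin) j σ ∧ σ.N ≤ N ∧
      (1 - (q : ℝ) ^ σ.sB) ^ σ.k ≤ δ ∧ S ⊆ (winLDataIn G φ Ω lo hi o Sfin).X j ∧ S ⊆ D ∧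
      (∀ x ∈ σ.K, ∀ e ∈ σ.seed x, e ∉ wireSet (↑S : Set V)) ∧ (∀ x ∈ σ.K, σ.face x ⊆ S) ∧
      (∀ x ∈ σ.K, 1 - 3 * δ ≤ (prodBernoulli Wt).real {ω | ∃ u ∈ σ.face x,
        1 - δ < (prodBernoulli (pinW Wt (wireSet (↑S : Set V)) ω)).real (⋃ t ∈ T, openConnIn (↑D : Set V) u t)}) := by
  set κ := slabGeomDeep G φ w₀ R lo hi j ℓs M R' r₀ Unear with hκ
  set Spin := pinSetHab G φ Ω w₀ R lo hi j ℓs r₀ κ with hSpin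
  have hOK := kitOK_slabDeep hlip hstep hΔ hwide hR' hr₀ hR hrs hU
  have hr₀1 : 1 ≤ r₀ := by omega
  have hrs1 : 1 ≤ rs := by omega
  have hcS1 : 1 ≤ (Δ + 1) ^ R' + (tanOff ℓs M + 2) := by omega
  have hOKh : KitOKHab G φ Ω lo hi j rs ((Δ + 1) ^ R' + (tanOff ℓs M + 2)) cU (habPad G φ Ω w₀ R lo hi j κ) :=
    kitOKHab_pad hOK hfull hrs1 hcS1 hU.one_le
  have hSX : Spin ⊆ winLevelIn φ Ω lo hi j := pinSetHab_subset_winLevelIn hlip hfull hr₀1 hR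
  have hSD : Spin ⊆ D := hSX.trans hXD
  -- faces lie in the pinning set
  have hface : ∀ x ∈ outerBoundary (winGraphIn G Ω) (winLevelIn φ Ω lo hi j), (habPad G φ Ω w₀ R lo hi j κ).U x ⊆ Spin := by
    intro x hx u hu
    rw [hSpin, pinSetHab, Finset.mem_union]
    by_cases hp : x ∈ outerBoundary (winGraph G w₀ R) (winLevel G φ w₀ R lo hi j)
    · rw [(habPad_of_mem hp).2.2] at hu
      simp only [hκ, slabGeomDeep] at hu
      split_ifs at hu with hnear
      · left
        rw [mem_Win]
        exact ⟨((mem_winLevel_iff G φ).1 (hU.sub x hp hnear hu)).1, hUsh x hp u hu⟩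
      · right
        rw [Finset.mem_singleton] at hu
        rw [hu, farSetHab, Finset.mem_image]
        refine ⟨x, Finset.mem_filter.2 ⟨hx, fun h => hnear h.2⟩, ?_⟩
        rw [(habPad_of_mem hp).1]
        rfl
    · rw [(habPad_of_not_mem hp).2.2, Finset.mem_singleton] at hu
      right
      rw [hu, farSetHab, Finset.mem_image]
      exact ⟨x, Finset.mem_filter.2 ⟨hx, fun h => hp h.1⟩, (habPad_of_not_mem hp).1⟩
  refine ⟨kitSDataHab G φ hΔ Ω lo hi j (habPad G φ Ω w₀ R lo hi j κ) rs ((Δ + 1) ^ R' + (tanOff ℓs M + 2)) cU k, Spin,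
    shyp_kitHab hlip hOKh o Sfin k, hN, hk, by rw [winLDataIn_X]; exact hSX, hSD, fun x hx e he => ?_, fun x hx => ?_, fun x hx => ?_⟩
  · -- seeds avoid the pairs of the pinning set
    rw [kitSDataHab_K] at hx
    rw [kitSDataHab_seed] at he
    by_cases hp : x ∈ outerBoundary (winGraph G w₀ R) (winLevel G φ w₀ R lo hi j)
    · rw [kitSeed_congr (habPad_of_mem hp).1 (habPad_of_mem hp).2.1 (habPad_of_mem hp).2.2] at he
      exact slabSeedDeep_notMem_wireSet hlip hstep hℓs hwide hUsh hp (pinSetHab_spec hlip hfull hr₀1 hR) he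
    · intro hw
      have hS1 : (habPad G φ Ω w₀ R lo hi j κ).S x = {(habPad G φ Ω w₀ R lo hi j κ).y x} := by
        rw [(habPad_of_not_mem hp).2.1, (habPad_of_not_mem hp).1]
      have hU1 : (habPad G φ Ω w₀ R lo hi j κ).U x = {(habPad G φ Ω w₀ R lo hi j κ).y x} := by
        rw [(habPad_of_not_mem hp).2.2, (habPad_of_not_mem hp).1]
      have hxS : x ∈ Spin := Finset.mem_coe.1 (hw.1 x (mem_kitSeed_pad hS1 hU1 he))
      have hx' : x ∈ outerBoundary (winGraphIn G Ω) (WinIn φ Ω (Finset.Icc (lo - (j : Site 2)) (hi + (j : Site 2)))) := hx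
      exact ((mem_outerBoundary_winIn_iff G φ).1 hx').2.1 ((mem_winLevelIn_iff φ).1 (hSX hxS)).2
  · rw [kitSDataHab_K] at hx; rw [kitSDataHab_face]; exact hface x hx
  · -- Step IV: face-in-target shortcut, or (plain near contact) the given estimate
    rw [kitSDataHab_K] at hx
    rw [kitSDataHab_face]
    rcases hcon x hx with ⟨u, hu, huT⟩ | ⟨hp, hnear, hIV⟩
    · exact hIV_of_mem_face hδ hu huT (hSD (hface x hx hu))
    · have hUx : (habPad G φ Ω w₀ R lo hi j κ).U x = Unear x := by
        rw [(habPad_of_mem hp).2.2]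
        simp only [hκ, slabGeomDeep, if_pos hnear]
      rw [hUx]
      exact hIV

/-! ## §3 The kit clause over the habitat graph with the two-scale rectangle kit -/

section TwoScale

variable {types : Finset V} {w₀ : V} {R : ℕ} {lo hi : Site 2} {j ℓs M : ℕ} {A : Fin 2 → Fin 2 → ℕ} {Rk : Fin 2 → ℕ} {K : ℕ}

/-- **The kit clause over `winGraphIn G Ω` with the two-scale rectangle kit** (Step IV via `KNLevels.stepIV_out` over the habitat graph):
`Skelφ.kitClause'` with the exploration graph `winGraphIn G Ω`, `Ω ⊇ winLevel` (so the pinned kit region `Qk ⊆` shell window lies in `Ω` and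
in `D ⊇ winLevelIn`). [cite: KozmaNitzan2024, §4 Lemma 10, Steps III–IV (pp. 19–21)] -/
theorem kitClauseHab' [Countable V] (hlip : Lip G φ) (hstep : Steps G φ) (hfr : Frames G φ types) (hκ : CylConn G φ types) {Δ : ℕ}
    (hΔ : ∀ v, G.degree v ≤ Δ) {q : unitInterval} {δ : ℝ} (hδ : 0 < δ)
    {R' r₀ rs : ℕ} (hℓs : 1 ≤ ℓs) (hwide : ∀ i, (lo - (j : Site 2)) i + 2 * tanOff ℓs M ≤ (hi + (j : Site 2)) i)
    (hA : ∀ i k, A i k ≤ M) (hAℓ : ∀ i, A i (oth i) ≤ ℓs) (hK : ∀ i, ℓs + 1 + A i i + Rk i ≤ K)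
    (Λc : V → ℕ → Finset V) {kz n ρ : ℕ} (hkn : ∀ c, Λc c kz ⊆ Λc c n)
    (hΛρ : ∀ c, ∀ z ∈ Λc c n, z ∈ graphBall G c ρ ∧ z ∈ cyl φ c n) (hnA : ∀ i, n + 1 ≤ A i i) (hnM : n ≤ M)
    (hρK : ∀ i, ℓs + 1 + A i i + ρ ≤ K)
    (hR'₁ : cylRadMax G φ types ℓs (ℓs + 2 + 2 * tanOff ℓs M) ≤ R') (hR'₂ : ∀ i, cylRadMax G φ types ℓs (ℓs + 2 + A i i + Rk i) ≤ R')
    (hr₀₁ : ℓs + 1 + tanOff ℓs M + R' ≤ r₀) (hr₀₂ : ℓs + 2 + tanOff ℓs M + K ≤ r₀) (hR : r₀ ≤ R)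
    (hrs₁ : ℓs + 2 + tanOff ℓs M + R' ≤ rs) (hrs₂ : ℓs + 2 + tanOff ℓs M + K ≤ rs) {cU : ℕ} (hcU : ∀ i, (Δ + 1) ^ Rk i ≤ cU)
    {Ω : Finset V} (hfull : winLevel G φ w₀ R lo hi j ⊆ Ω)
    (k : ℕ) (o : V) (Sfin : Finset V) {Wt : Sym2 V → unitInterval} {D T : Finset V}
    (hWD : IsSubbox (winGraphIn G Ω) Wt q D) (hXD : winLevelIn φ Ω lo hi j ⊆ D) {N : ℕ} (hN : k * (Δ + 1) ^ (2 * rs) ≤ N)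
    (hk : (1 - (q : ℝ) ^ (1 + Δ * ((Δ + 1) ^ R' + (tanOff ℓs M + 2)) + ((Δ + 1) ^ R' + (tanOff ℓs M + 2)) * cU)) ^ k ≤ δ)
    (hcon' : ∀ x ∈ outerBoundary (winGraphIn G Ω) (winLevelIn φ Ω lo hi j),
      (∃ u ∈ (habPad G φ Ω w₀ R lo hi j (slabGeomDeep G φ w₀ R lo hi j ℓs M R' r₀ (rectU hstep w₀ R lo hi j ℓs M A Rk))).U x, u ∈ T) ∨
      (x ∈ outerBoundary (winGraph G w₀ R) (winLevel G φ w₀ R lo hi j) ∧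
        inNbr G φ w₀ R (Finset.Icc (lo - (j : Site 2)) (hi + (j : Site 2))) x ∈ graphBall G w₀ (R - r₀) ∧
        1 - δ ^ 2 < (bondPercolation G q).real (UniqZone.zone G
          (Λc (rectCtr hstep (deepCtr G φ w₀ R (lo - (j : Site 2)) (hi + (j : Site 2)) ℓs M x)
            (exitDir G φ w₀ R (lo - (j : Site 2)) (hi + (j : Site 2)) x).1 (exitDir G φ w₀ R (lo - (j : Site 2)) (hi + (j : Site 2)) x).2 ℓs
            (A (exitDir G φ w₀ R (lo - (j : Site 2)) (hi + (j : Site 2)) x).1))) kz n) ∧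
        1 - δ ^ 2 < (bondPercolation G q).real (linkIn
          (rectPrism G φ (rectCtr hstep (deepCtr G φ w₀ R (lo - (j : Site 2)) (hi + (j : Site 2)) ℓs M x)
            (exitDir G φ w₀ R (lo - (j : Site 2)) (hi + (j : Site 2)) x).1 (exitDir G φ w₀ R (lo - (j : Site 2)) (hi + (j : Site 2)) x).2 ℓs
            (A (exitDir G φ w₀ R (lo - (j : Site 2)) (hi + (j : Site 2)) x).1))
            (A (exitDir G φ w₀ R (lo - (j : Site 2)) (hi + (j : Site 2)) x).1) (Rk (exitDir G φ w₀ R (lo - (j : Site 2)) (hi + (j : Site 2)) x).1))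
          (Λc (rectCtr hstep (deepCtr G φ w₀ R (lo - (j : Site 2)) (hi + (j : Site 2)) ℓs M x)
            (exitDir G φ w₀ R (lo - (j : Site 2)) (hi + (j : Site 2)) x).1 (exitDir G φ w₀ R (lo - (j : Site 2)) (hi + (j : Site 2)) x).2 ℓs
            (A (exitDir G φ w₀ R (lo - (j : Site 2)) (hi + (j : Site 2)) x).1)) kz)
          (rectU hstep w₀ R lo hi j ℓs M A Rk x)) ∧
        ∃ Qt Ft : Finset V, Ft ⊆ T ∧ Qt ⊆ D ∧
          Disjoint Ft (Λc (rectCtr hstep (deepCtr G φ w₀ R (lo - (j : Site 2)) (hi + (j : Site 2)) ℓs M x)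
            (exitDir G φ w₀ R (lo - (j : Site 2)) (hi + (j : Site 2)) x).1 (exitDir G φ w₀ R (lo - (j : Site 2)) (hi + (j : Site 2)) x).2 ℓs
            (A (exitDir G φ w₀ R (lo - (j : Site 2)) (hi + (j : Site 2)) x).1)) n) ∧
          1 - δ ^ 2 < (prodBernoulli Wt).real (linkIn (↑Qt)
            (Λc (rectCtr hstep (deepCtr G φ w₀ R (lo - (j : Site 2)) (hi + (j : Site 2)) ℓs M x)
              (exitDir G φ w₀ R (lo - (j : Site 2)) (hi + (j : Site 2)) x).1 (exitDir G φ w₀ R (lo - (j : Site 2)) (hi + (j : Site 2)) x).2 ℓs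
              (A (exitDir G φ w₀ R (lo - (j : Site 2)) (hi + (j : Site 2)) x).1)) kz) Ft))) :
    ∃ (σ : SData V) (S : Finset V), SHyp (winLDataIn G φ Ω lo hi o Sfin) j σ ∧ σ.N ≤ N ∧
      (1 - (q : ℝ) ^ σ.sB) ^ σ.k ≤ δ ∧ S ⊆ (winLDataIn G φ Ω lo hi o Sfin).X j ∧ S ⊆ D ∧
      (∀ x ∈ σ.K, ∀ e ∈ σ.seed x, e ∉ wireSet (↑S : Set V)) ∧ (∀ x ∈ σ.K, σ.face x ⊆ S) ∧
      (∀ x ∈ σ.K, 1 - 3 * δ ≤ (prodBernoulli Wt).real {ω | ∃ u ∈ σ.face x,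
        1 - δ < (prodBernoulli (pinW Wt (wireSet (↑S : Set V)) ω)).real (⋃ t ∈ T, openConnIn (↑D : Set V) u t)}) := by
  have hR'slab : ∀ c : V, graphBall G c (ℓs + 2 + 2 * tanOff ℓs M) ∩ cyl φ c ℓs ⊆ cylBall G φ c ℓs R' := fun c v hv =>
    cylBall_mono G φ c le_rfl hR'₁ (graphBall_inter_cyl_subset_cylBall' hfr hκ c hℓs (ℓs + 2 + 2 * tanOff ℓs M) hv)
  have hU := nearFaceOK_rect (w₀ := w₀) hlip hstep hfr hκ hΔ hℓs hwide hA hAℓ hK hR'₂ hr₀₂ hR hrs₂ hcU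
  have hUsh := rectU_mem_shellBox hlip hstep hwide hA hK (w₀ := w₀) (R := R) (lo := lo) (hi := hi) (j := j) (Rk := Rk)
  -- the shell window is pinned, lies in `Ω` and in the region
  have hshellΩ : Win G φ w₀ (Finset.Icc (lo - (j : Site 2) + ((2 * ℓs + 2 : ℕ) : Site 2)) (hi + (j : Site 2) - ((2 * ℓs + 2 : ℕ) : Site 2))) R ⊆ Ω :=
    (shellWin_subset_winLevel G φ w₀ R lo hi j ℓs).trans hfull
  have hshellD : Win G φ w₀ (Finset.Icc (lo - (j : Site 2) + ((2 * ℓs + 2 : ℕ) : Site 2)) (hi + (j : Site 2) - ((2 * ℓs + 2 : ℕ) : Site 2))) R ⊆ D :=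
    ((shellWin_subset_winLevel G φ w₀ R lo hi j ℓs).trans (winLevel_subset_winLevelIn hfull)).trans hXD
  refine kitClauseHab hlip hstep hΔ hδ hℓs hwide hR'slab hr₀₁ hR hrs₁ hU hUsh hfull k o Sfin hXD hN hk fun x hx => ?_
  rcases hcon' x hx with h | ⟨hp, hnear, hz, hl, Qt, Ft, hFT, hQD, hdisj, h3⟩
  · exact Or.inl h
  · refine Or.inr ⟨hp, hnear, ?_⟩
    generalize hI : (exitDir G φ w₀ R (lo - (j : Site 2)) (hi + (j : Site 2)) x).1 = I at hz hl hdisj h3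
    generalize hS : (exitDir G φ w₀ R (lo - (j : Site 2)) (hi + (j : Site 2)) x).2 = sg at hz hl hdisj h3
    have hrectU : rectU hstep w₀ R lo hi j ℓs M A Rk x =
        nearSide G hstep (deepCtr G φ w₀ R (lo - (j : Site 2)) (hi + (j : Site 2)) ℓs M x) I sg ℓs (A I) (Rk I) := by
      rw [rectU, hI, hS]
    -- ROOM: the rectangle and the zone box lie in the shell window
    have hrectS := rectPrism_subset_shellWin hlip hstep hwide hA hK (le_trans (by omega) hr₀₂) hR hp hnear
    have hzoneS := zoneBox_subset_shellWin hlip hstep hwide hA (fun i => (Nat.le_succ n).trans (hnA i)) hnM hρK hr₀₂ hR hp hnear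
      (hΛρ _)
    rw [hI, hS] at hrectS hzoneS
    set t := deepCtr G φ w₀ R (lo - (j : Site 2)) (hi + (j : Site 2)) ℓs M x with ht
    set c := rectCtr hstep t I sg ℓs (A I) with hc
    set Qk : Finset V := rectPrismFin G φ c (A I) (Rk I) ∪ Λc c n with hQk
    have hQkS' : Qk ⊆ Win G φ w₀ (Finset.Icc (lo - (j : Site 2) + ((2 * ℓs + 2 : ℕ) : Site 2))
        (hi + (j : Site 2) - ((2 * ℓs + 2 : ℕ) : Site 2))) R := Finset.union_subset hrectS hzoneS
    have hQkS : Qk ⊆ pinSetHab G φ Ω w₀ R lo hi j ℓs r₀ (slabGeomDeep G φ w₀ R lo hi j ℓs M R' r₀ (rectU hstep w₀ R lo hi j ℓs M A Rk)) :=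
      hQkS'.trans Finset.subset_union_left
    have hQkD : Qk ⊆ D := hQkS'.trans hshellD
    have hQkΩ : Qk ⊆ Ω := hQkS'.trans hshellΩ
    have hΛQk : Λc c n ⊆ Qk := Finset.subset_union_right
    have hrectQk : rectPrismFin G φ c (A I) (Rk I) ⊆ Qk := Finset.subset_union_left
    have hUfar : Disjoint (nearSide G hstep t I sg ℓs (A I) (Rk I)) (Λc c n) :=
      disjoint_nearSide_of_subset_cyl hstep (hnA I) fun z hz' => (hΛρ c z hz').2
    -- the inputs, transferred to the subbox weighting of the habitat graph
    have h1 : 1 - δ ^ 2 < (prodBernoulli Wt).real (UniqZone.zone (winGraphIn G Ω) (Λc c) kz n) := by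
      have heq := Skel.real_eq_of_isSubbox_of_le (winGraphIn_le G Ω) hWD (hΛQk.trans hQkD)
        (Skel.adj_winGraphIn_of_subset (hΛQk.trans hQkΩ))
        (determinedBy_zone (G := G) (Λc c) kz n le_rfl) (measurableSet_zone (G := G) (Λc c) kz n)
      refine hz.trans_le ?_
      rw [← heq]
      exact measureReal_mono (zone_anti_graph (winGraphIn_le G Ω) (Λc c) kz n) (measure_ne_top _ _)
    have h2 : 1 - δ ^ 2 < (prodBernoulli Wt).real (linkIn (↑Qk) (Λc c kz) (nearSide G hstep t I sg ℓs (A I) (Rk I))) := by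
      have heq := Skel.real_eq_of_isSubbox_of_le (winGraphIn_le G Ω) hWD (hrectQk.trans hQkD)
        (Skel.adj_winGraphIn_of_subset (hrectQk.trans hQkΩ))
        (determinedBy_linkIn (rectPrism G φ c (A I) (Rk I)) (Λc c kz) (nearSide G hstep t I sg ℓs (A I) (Rk I))
          (by rw [coe_rectPrismFin]))
        (by rw [← coe_rectPrismFin]; exact measurableSet_linkIn _ _ _)
      rw [hrectU] at hl
      rw [← heq] at hl
      refine hl.trans_le (measureReal_mono (linkIn_mono ?_ subset_rfl subset_rfl) (measure_ne_top _ _))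
      rw [← coe_rectPrismFin]
      exact Finset.coe_subset.2 hrectQk
    rw [hrectU]
    exact KNLevels.stepIV_out (G := winGraphIn G Ω) hWD hFT hQD (Λc c) (hkn c) hQkD hQkS hΛQk hUfar hdisj hδ (Rg := (↑D : Set V))
      (Finset.coe_subset.2 hQkD) (Finset.coe_subset.2 hQD) h1 h2 h3

end TwoScale

end Skelφ

end Summit.CriticalPhenomena.PercolationContinuityZ3.Theorems.Transplant

end
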